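import Literature.Analysis.FluidPDE.CriticalRegularity
import Literature.Analysis.FluidPDE.GKPCriticalElements
import Literature.Analysis.FluidPDE.BoundedRepresentative
import Literature.Analysis.FunctionSpaces.BesovPairing
import Mathlib.MeasureTheory.Covering.DensityTheorem
import Mathlib.MeasureTheory.Integral.Average
import HarnessLib

/-!
# Pairings and bounds for families of distributions continuous in a Besov space

Analysis/FluidPDE support file (all results proved), bricks `K5`/`K0` in the plan of
`NSCriticalClosureBesovBounded.lean` for the smoothing fact
`Literature.Analysis.FluidPDE.knss_classical_of_bounded_isBesovMildSolutionOn` (Koch–Nadirashvili–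
Seregin–Šverák 2009, §4). The class `IsBesovMildSolutionOn` of `CriticalRegularity.lean`
controls the slices `u t` through their distributions `U t` and the continuity of `t ↦ U t` in
`Ḃ^{s_p}_{p,q}`, `s_p = -1 + 3/p ∈ (-1, 0)`; the regularity theory of KNSS is about bounded
functions. This file translates between the two:

* `ContinuousInHomBesovOn.tendsto_apply` (`K5`): for `-2 < s < 0` a family continuous in
  `Ḃ^s_{p,q}` has all its pairings `t ↦ ⟨U t, θ⟩` with Schwartz functions continuous
  (`Literature.Analysis.FunctionSpaces.exists_nnnorm_apply_le_mul_eHomBesovNorm`, BCD Prop. 2.27);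
* `IsDistributionOf.locallyIntegrable`, `IsDistributionOf.eLpNorm_top_le_of_forall_schwartz`
  (`D`): a field whose distribution satisfies `‖⟨G, θ⟩‖ ≤ C ‖θ‖_{L¹}` for all Schwartz `θ` is
  essentially bounded by `C` (smooth bumps approximating the indicator of a ball, then the
  Lebesgue differentiation theorem, Mathlib `IsUnifLocDoublingMeasure.ae_tendsto_average`);
* `eLpNorm_top_zero_le_of_continuousInHomBesovOn` (`K0`): if the slices `u t`, `0 < t < T₁`, are
  essentially bounded by `C` and `U ∈ C([0, T); Ḃ^s_{p,q})`, then so is the initial slice `u 0`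
  (the bound passes to the limit `t → 0⁺` in the pairings, then `D`).

## References

* H. Bahouri, J.-Y. Chemin, R. Danchin, *Fourier Analysis and Nonlinear PDE* (2011), Prop. 2.27.
  [BahouriCheminDanchin2011]
* G. Koch, N. Nadirashvili, G. Seregin, V. Šverák, Acta Math. 203 (2009), §4 (the `L^∞` class).
  [KochNadirashviliSereginSverak2009]
-/

noncomputable section

open MeasureTheory Set Function Filter TopologicalSpace Metric
open _root_.Topology
open scoped RealInnerProductSpace NNReal ENNReal SchwartzMap

namespace Literature.Analysis.FluidPDE

/-! ### `K5`: continuity of the pairings -/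

section Pairings

variable {ι : Type*} [Fintype ι]

/-- **A family continuous in `Ḃ^s_{p,q}` (`-2 < s < 0`, `1 ≤ q`) has continuous pairings with
Schwartz functions**: `t ↦ ⟨U t, θ⟩` is continuous on `S` for every `θ ∈ 𝓢`. The increments
`U t - U t₀` are realised (`Ṡ_j → 0`, by linearity) and
`‖⟨U t - U t₀, θ⟩‖ ≤ K ‖U t - U t₀‖_{Ḃ^s_{p,∞}} ≤ K ‖U t - U t₀‖_{Ḃ^s_{p,q}} → 0`
(`Literature.Analysis.FunctionSpaces.exists_nnnorm_apply_le_mul_eHomBesovNorm`, BCD Prop. 2.27).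
[cite: BahouriCheminDanchin2011, Prop. 2.27] -/
theorem ContinuousInHomBesovOn.tendsto_apply {S : Set ℝ} {s : ℝ} {p q : ℝ≥0∞} [Fact (1 ≤ p)]
    (hs0 : s < 0) (hs2 : -2 < s) (hq : 1 ≤ q)
    {U : ℝ → 𝓢'(EuclideanSpace ℝ ι, EuclideanSpace ℂ ι)} (hU : ContinuousInHomBesovOn S s p q U)
    (θ : 𝓢(EuclideanSpace ℝ ι, ℂ)) {t₀ : ℝ} (ht₀ : t₀ ∈ S) :
    Tendsto (fun t => U t θ) (𝓝[S] t₀) (𝓝 (U t₀ θ)) := by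
  haveI : p.HolderConjugate (1 - p⁻¹)⁻¹ :=
    ENNReal.HolderConjugate.inv_one_sub_inv' (Fact.out : 1 ≤ p)
  obtain ⟨K, hK⟩ := FunctionSpaces.exists_nnnorm_apply_le_mul_eHomBesovNorm
    (E := EuclideanSpace ℝ ι) (F := EuclideanSpace ℂ ι) p (1 - p⁻¹)⁻¹ (σ := -s)
    (by linarith) (by linarith) θ
  simp only [neg_neg] at hK
  -- realisation of the increments
  have hreal : ∀ t ∈ S, Tendsto (fun j : ℤ => FunctionSpaces.lowFreqCutoff j (U t - U t₀)) atBot (𝓝 0) := by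
    intro t ht
    have h := ((hU.1 t ht).2).sub ((hU.1 t₀ ht₀).2)
    simpa only [map_sub, sub_zero] using h
  -- squeeze in `ℝ≥0∞`
  have hq0 : q ≠ 0 := (lt_of_lt_of_le one_pos hq).ne'
  have hupper : Tendsto (fun t => (K : ℝ≥0∞) * FunctionSpaces.eHomBesovNorm s p q (U t - U t₀))
      (𝓝[S] t₀) (𝓝 0) := by
    have h := ENNReal.Tendsto.const_mul (hU.2 t₀ ht₀) (Or.inr ENNReal.coe_ne_top) (a := (K : ℝ≥0∞))
    rwa [mul_zero] at h
  have hle : ∀ᶠ t in 𝓝[S] t₀, (‖U t θ - U t₀ θ‖₊ : ℝ≥0∞) ≤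
      (K : ℝ≥0∞) * FunctionSpaces.eHomBesovNorm s p q (U t - U t₀) := by
    filter_upwards [eventually_mem_nhdsWithin] with t ht
    calc (‖U t θ - U t₀ θ‖₊ : ℝ≥0∞) = ‖(U t - U t₀) θ‖₊ := by rfl
      _ ≤ K * FunctionSpaces.eHomBesovNorm s p ∞ (U t - U t₀) := hK _ (hreal t ht)
      _ ≤ K * FunctionSpaces.eHomBesovNorm s p q (U t - U t₀) := by
          gcongr
          exact eHomBesovNorm_exponent_antitone s p hq0 le_top _
  have hzero : Tendsto (fun t => (‖U t θ - U t₀ θ‖₊ : ℝ≥0∞)) (𝓝[S] t₀) (𝓝 0) :=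
    tendsto_of_tendsto_of_tendsto_of_le_of_le' tendsto_const_nhds hupper
      (Eventually.of_forall fun _ => bot_le) hle
  rw [tendsto_iff_norm_sub_tendsto_zero]
  have h1 : Tendsto (fun t => ‖U t θ - U t₀ θ‖₊) (𝓝[S] t₀) (𝓝 0) :=
    ENNReal.tendsto_coe.1 (by simpa using hzero)
  have h2 := NNReal.tendsto_coe.2 h1
  simpa only [coe_nnnorm, NNReal.coe_zero] using h2

end Pairings

/-! ### `D`: essential bounds from bounds on the pairings -/

section EssBound

variable {ι : Type*} [Fintype ι] {E : Type*} [NormedAddCommGroup E] [InnerProductSpace ℝ E]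
  [FiniteDimensional ℝ E] [MeasurableSpace E] [BorelSpace E]

/-- **A field with a tempered distribution is locally integrable**: `θ • u₀` is integrable for
the Gaussian `θ = e^{-‖x‖²}`, which is bounded below by a positive constant on every compact
set. [folklore] -/
theorem IsDistributionOf.locallyIntegrable {u₀ : E → EuclideanSpace ℝ ι}
    {U : 𝓢'(E, EuclideanSpace ℂ ι)} (h : IsDistributionOf u₀ U) :
    LocallyIntegrable u₀ volume := by
  have hmeas : AEStronglyMeasurable u₀ volume := h.aestronglyMeasurable
  refine (locallyIntegrable_iff (μ := (volume : Measure E))).2 fun K hK => ?_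
  obtain ⟨R, hR⟩ := hK.isBounded.subset_closedBall 0
  set θ : 𝓢(E, ℂ) := FunctionSpaces.gaussianSchwartz E 1 with hθ
  have hθx : ∀ x, θ x = ((Real.exp (-1 * ‖x‖ ^ 2) : ℝ) : ℂ) := fun x =>
    FunctionSpaces.gaussianSchwartz_apply one_pos x
  set c : ℝ := Real.exp (-1 * R ^ 2) with hc
  have hc0 : 0 < c := Real.exp_pos _
  have hint : Integrable (fun x => θ x • FunctionSpaces.EuclideanSpace.complexify (u₀ x)) volume :=
    (h θ).1
  -- on `K ⊆ closedBall 0 R`, `‖u₀ x‖ ≤ c⁻¹ ‖θ x • complexify (u₀ x)‖`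
  have hle : ∀ x ∈ K, ‖u₀ x‖ ≤ c⁻¹ * ‖θ x • FunctionSpaces.EuclideanSpace.complexify (u₀ x)‖ := by
    intro x hx
    have hxR : ‖x‖ ≤ R := by simpa using hR hx
    have hθge : c ≤ ‖θ x‖ := by
      rw [hθx, Complex.norm_real, Real.norm_of_nonneg (Real.exp_pos _).le, hc]
      refine Real.exp_le_exp.2 ?_
      have : ‖x‖ ^ 2 ≤ R ^ 2 := pow_le_pow_left₀ (norm_nonneg _) hxR 2
      linarith
    rw [norm_smul, FunctionSpaces.EuclideanSpace.norm_complexify, le_inv_mul_iff₀ hc0]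
    exact mul_le_mul_of_nonneg_right hθge (norm_nonneg _)
  refine Integrable.mono' ((hint.norm.const_mul c⁻¹).integrableOn) hmeas.restrict ?_
  exact (ae_restrict_iff' hK.measurableSet).2 (Eventually.of_forall hle)

/-- **Ball averages from pairings with bumps**: if `‖⟨U, θ⟩‖ ≤ C ‖θ‖_{L¹}` for every Schwartz
`θ`, then `‖∫_{B̄(x,r)} u₀‖ ≤ C |B̄(x,r)|` (test against smooth bumps `χ_n ↓ 1_{B̄(x,r)}`,
dominated convergence). [folklore] -/
theorem IsDistributionOf.norm_setIntegral_closedBall_le {u₀ : E → EuclideanSpace ℝ ι}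
    {U : 𝓢'(E, EuclideanSpace ℂ ι)} (h : IsDistributionOf u₀ U) {C : ℝ}
    (hθ : ∀ θ : 𝓢(E, ℂ), ‖U θ‖ ≤ C * ∫ x, ‖θ x‖) (x : E) {r : ℝ} (hr : 0 < r) :
    ‖∫ y in closedBall x r, u₀ y‖ ≤ C * (volume (closedBall x r)).toReal := by
  have hloc := h.locallyIntegrable
  -- the bumps `χ_n`: `= 1` on `B̄(x, r)`, supported in `B(x, r + 1/(n+1))`
  set χ : ℕ → ContDiffBump x := fun n =>
    ⟨r, r + 1 / ((n : ℝ) + 1), hr, by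
      have : (0 : ℝ) < 1 / ((n : ℝ) + 1) := by positivity
      linarith⟩ with hχ
  have hχ1 : ∀ n, ∀ y ∈ closedBall x r, (χ n : E → ℝ) y = 1 := fun n y hy =>
    (χ n).one_of_mem_closedBall hy
  have hrout : ∀ n, (χ n).rOut = r + 1 / ((n : ℝ) + 1) := fun n => rfl
  have hχsupp : ∀ n y, (χ n : E → ℝ) y ≠ 0 → y ∈ closedBall x (r + 1) := by
    intro n y hy
    have hy' : y ∈ Function.support (χ n : E → ℝ) := hy
    rw [(χ n).support_eq, hrout n] at hy'
    have h1 : 1 / ((n : ℝ) + 1) ≤ 1 := by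
      rw [div_le_one (by positivity)]
      linarith [n.cast_nonneg (α := ℝ)]
    exact mem_closedBall.2 ((mem_ball.1 hy').le.trans (by linarith))
  -- pointwise limit of the bumps: the indicator of the closed ball
  have hlim : ∀ y, Tendsto (fun n => (χ n : E → ℝ) y) atTop
      (𝓝 ((closedBall x r).indicator (fun _ => (1 : ℝ)) y)) := by
    intro y
    by_cases hy : y ∈ closedBall x r
    · simp only [indicator_of_mem hy, hχ1 _ y hy]
      exact tendsto_const_nhds
    · rw [indicator_of_notMem hy]
      have hdist : r < dist y x := by simpa [mem_closedBall] using hy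
      have hev : ∀ᶠ n : ℕ in atTop, (χ n : E → ℝ) y = 0 := by
        have h1 : Tendsto (fun n : ℕ => r + 1 / ((n : ℝ) + 1)) atTop (𝓝 (r + 0)) :=
          tendsto_const_nhds.add tendsto_one_div_add_atTop_nhds_zero_nat
        rw [add_zero] at h1
        filter_upwards [h1.eventually (gt_mem_nhds hdist)] with n hn
        exact (χ n).zero_of_le_dist hn.le
      exact tendsto_const_nhds.congr' (hev.mono fun n hn => hn.symm)
  -- the complex Schwartz versions of the bumps and the hypothesis on them
  have hcs : ∀ n, HasCompactSupport fun y => ((χ n : E → ℝ) y : ℂ) := fun n =>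
    (χ n).hasCompactSupport.comp_left Complex.ofReal_zero
  have hcd : ∀ n, ContDiff ℝ ((⊤ : ℕ∞) : WithTop ℕ∞) fun y => ((χ n : E → ℝ) y : ℂ) := fun n =>
    Complex.ofRealCLM.contDiff.comp (χ n).contDiff
  have hpair : ∀ n, ‖∫ y, (χ n : E → ℝ) y • u₀ y‖ ≤ C * ∫ y, (χ n : E → ℝ) y := by
    intro n
    set θn : 𝓢(E, ℂ) := (hcs n).toSchwartzMap (hcd n) with hθn
    have hθn_apply : ∀ y, θn y = ((χ n : E → ℝ) y : ℂ) := fun y => rfl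
    have h1 := hθ θn
    have h2 : U θn = FunctionSpaces.EuclideanSpace.complexify (∫ y, (χ n : E → ℝ) y • u₀ y) := by
      rw [(h θn).2]
      have e : (fun y => θn y • FunctionSpaces.EuclideanSpace.complexify (u₀ y)) =
          fun y => FunctionSpaces.EuclideanSpace.complexify ((χ n : E → ℝ) y • u₀ y) := by
        funext y
        rw [hθn_apply, map_smul, Complex.coe_smul]
      rw [e]
      exact (FunctionSpaces.EuclideanSpace.complexify (ι := ι)).toContinuousLinearMap.integral_comp_comm
        (hloc.integrable_smul_left_of_hasCompactSupport (χ n).continuous (χ n).hasCompactSupport)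
    have h3 : ‖U θn‖ = ‖∫ y, (χ n : E → ℝ) y • u₀ y‖ := by
      rw [h2]
      exact FunctionSpaces.EuclideanSpace.norm_complexify _
    have h4 : ∫ y, ‖θn y‖ = ∫ y, (χ n : E → ℝ) y := by
      refine integral_congr_ae (Eventually.of_forall fun y => ?_)
      show ‖θn y‖ = (χ n : E → ℝ) y
      rw [hθn_apply, Complex.norm_real, Real.norm_of_nonneg (χ n).nonneg]
    rw [← h3, ← h4]
    exact h1
  -- dominated convergence for `∫ χ_n • u₀` and `∫ χ_n`
  have hK1 : IntegrableOn u₀ (closedBall x (r + 1)) volume :=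
    hloc.integrableOn_isCompact (isCompact_closedBall x (r + 1))
  have hbound_int : Integrable (fun y => (closedBall x (r + 1)).indicator (fun y => ‖u₀ y‖) y) volume :=
    IntegrableOn.integrable_indicator hK1.norm measurableSet_closedBall
  have hmeasχ : ∀ n, AEStronglyMeasurable (fun y => (χ n : E → ℝ) y • u₀ y) volume := fun n =>
    (χ n).continuous.aestronglyMeasurable.smul h.aestronglyMeasurable
  have hI : Tendsto (fun n => ∫ y, (χ n : E → ℝ) y • u₀ y) atTop
      (𝓝 (∫ y, (closedBall x r).indicator (fun _ => (1 : ℝ)) y • u₀ y)) := by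
    refine tendsto_integral_of_dominated_convergence
      (fun y => (closedBall x (r + 1)).indicator (fun y => ‖u₀ y‖) y) hmeasχ hbound_int ?_ ?_
    · intro n
      refine Eventually.of_forall fun y => ?_
      by_cases hy : (χ n : E → ℝ) y = 0
      · simp [hy, indicator_nonneg (fun _ _ => norm_nonneg _)]
      · rw [indicator_of_mem (hχsupp n y hy), norm_smul, Real.norm_of_nonneg (χ n).nonneg]
        exact mul_le_of_le_one_left (norm_nonneg _) (χ n).le_one
    · exact Eventually.of_forall fun y => (hlim y).smul_const (u₀ y)
  have hJ : Tendsto (fun n => ∫ y, (χ n : E → ℝ) y) atTop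
      (𝓝 (∫ y, (closedBall x r).indicator (fun _ => (1 : ℝ)) y)) := by
    refine tendsto_integral_of_dominated_convergence
      (fun y => (closedBall x (r + 1)).indicator (fun _ => (1 : ℝ)) y)
      (fun n => (χ n).continuous.aestronglyMeasurable)
      ((integrableOn_const (measure_closedBall_lt_top (x := x) (r := r + 1)).ne).integrable_indicator
        measurableSet_closedBall) ?_ ?_
    · intro n
      refine Eventually.of_forall fun y => ?_
      by_cases hy : (χ n : E → ℝ) y = 0
      · simp [hy, indicator_nonneg]
      · rw [indicator_of_mem (hχsupp n y hy), Real.norm_of_nonneg (χ n).nonneg]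
        exact (χ n).le_one
    · exact Eventually.of_forall fun y => hlim y
  have hI' : ∫ y, (closedBall x r).indicator (fun _ => (1 : ℝ)) y • u₀ y = ∫ y in closedBall x r, u₀ y := by
    rw [← integral_indicator measurableSet_closedBall]
    refine integral_congr_ae (Eventually.of_forall fun y => ?_)
    by_cases hy : y ∈ closedBall x r
    · simp [indicator_of_mem hy]
    · simp [indicator_of_notMem hy]
  have hJ' : ∫ y, (closedBall x r).indicator (fun _ => (1 : ℝ)) y = (volume (closedBall x r)).toReal := by
    rw [integral_indicator measurableSet_closedBall, setIntegral_const, smul_eq_mul, mul_one,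
      Measure.real]
  rw [hI'] at hI
  rw [hJ'] at hJ
  exact le_of_tendsto_of_tendsto' (continuous_norm.continuousAt.tendsto.comp hI)
    (hJ.const_mul C) hpair

/-- **Essential bound from bounds on the pairings** (`D`): if the distribution of `u₀` satisfies
`‖⟨U, θ⟩‖ ≤ C ‖θ‖_{L¹}` for every Schwartz `θ` (`0 ≤ C`), then `‖u₀‖_{L^∞} ≤ C` — ball averages
are bounded by `C` (`norm_setIntegral_closedBall_le`), and `u₀(x)` is the limit of its ball
averages at a.e. `x` (Lebesgue's differentiation theorem). [folklore] -/
theorem IsDistributionOf.eLpNorm_top_le_of_forall_schwartz {u₀ : E → EuclideanSpace ℝ ι}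
    {U : 𝓢'(E, EuclideanSpace ℂ ι)} (h : IsDistributionOf u₀ U) {C : ℝ}
    (hθ : ∀ θ : 𝓢(E, ℂ), ‖U θ‖ ≤ C * ∫ x, ‖θ x‖) :
    eLpNorm u₀ ∞ volume ≤ ENNReal.ofReal C := by
  have hloc := h.locallyIntegrable
  have hae : ∀ᵐ x ∂(volume : Measure E), ‖u₀ x‖ ≤ C := by
    filter_upwards [IsUnifLocDoublingMeasure.ae_tendsto_average (μ := (volume : Measure E)) hloc 1]
      with x hx
    have hlim : Tendsto (fun δ : ℝ => ⨍ y in closedBall x δ, u₀ y) (𝓝[>] 0) (𝓝 (u₀ x)) :=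
      hx (fun _ => x) id tendsto_id (by
        filter_upwards [self_mem_nhdsWithin] with δ hδ
        rw [one_mul]
        exact mem_closedBall_self (le_of_lt hδ))
    refine le_of_tendsto ((continuous_norm.tendsto _).comp hlim) ?_
    filter_upwards [self_mem_nhdsWithin] with δ hδ
    have hpos : 0 < (volume (closedBall x δ)).toReal :=
      ENNReal.toReal_pos (measure_closedBall_pos volume x hδ).ne' (measure_closedBall_lt_top).ne
    rw [Function.comp_apply, setAverage_eq, norm_smul, Measure.real, norm_inv,
      Real.norm_of_nonneg hpos.le, inv_mul_le_iff₀ hpos]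
    calc ‖∫ y in closedBall x δ, u₀ y‖ ≤ C * (volume (closedBall x δ)).toReal :=
          h.norm_setIntegral_closedBall_le hθ x hδ
      _ = (volume (closedBall x δ)).toReal * C := mul_comm _ _
  rw [eLpNorm_exponent_top]
  exact eLpNormEssSup_le_of_ae_bound hae

end EssBound

/-! ### `K0`: the initial slice of a bounded Besov family is bounded -/

section InitialSlice

variable {ι : Type*} [Fintype ι]

/-- The pairing of a slice with a Schwartz function is bounded by `‖u t‖_{L^∞} ‖θ‖_{L¹}`. [folklore] -/
theorem IsDistributionOf.norm_apply_le_of_eLpNorm_top_le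
    {v : EuclideanSpace ℝ ι → EuclideanSpace ℝ ι}
    {V : 𝓢'(EuclideanSpace ℝ ι, EuclideanSpace ℂ ι)} (hV : IsDistributionOf v V) {C : ℝ≥0∞}
    (hC : C < ∞) (hb : eLpNorm v ∞ volume ≤ C) (θ : 𝓢(EuclideanSpace ℝ ι, ℂ)) :
    ‖V θ‖ ≤ C.toReal * ∫ x, ‖θ x‖ := by
  rw [(hV θ).2]
  have hae : ∀ᵐ x ∂(volume : Measure (EuclideanSpace ℝ ι)), ‖v x‖ ≤ C.toReal := by
    have h1 := ae_le_eLpNormEssSup (f := v) (μ := (volume : Measure (EuclideanSpace ℝ ι)))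
    filter_upwards [h1] with x hx
    rw [← eLpNorm_exponent_top] at hx
    have hx' : ‖v x‖ₑ ≤ C := hx.trans hb
    rw [← ofReal_norm] at hx'
    exact (ENNReal.ofReal_le_iff_le_toReal hC.ne).1 hx'
  calc ‖∫ x, θ x • FunctionSpaces.EuclideanSpace.complexify (v x)‖
      ≤ ∫ x, ‖θ x‖ * C.toReal := by
        refine norm_integral_le_of_norm_le (θ.integrable.norm.mul_const _) ?_
        filter_upwards [hae] with x hx
        rw [norm_smul, FunctionSpaces.EuclideanSpace.norm_complexify]
        exact mul_le_mul_of_nonneg_left hx (norm_nonneg _)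
    _ = C.toReal * ∫ x, ‖θ x‖ := by rw [integral_mul_const, mul_comm]

/-- **The initial slice is bounded** (`K0`). Let `U ∈ C([0, T); Ḃ^s_{p,q})` (`-2 < s < 0`,
`1 ≤ q`) be the distributions of the slices `u t`, and suppose `‖u t‖_{L^∞} ≤ C` for
`0 < t < T₁` (`T₁ ≤ T`). Then `‖u 0‖_{L^∞} ≤ C`: for every Schwartz `θ`,
`⟨U 0, θ⟩ = lim_{t → 0⁺} ⟨U t, θ⟩` (`ContinuousInHomBesovOn.tendsto_apply`) and
`‖⟨U t, θ⟩‖ ≤ C ‖θ‖_{L¹}`, so `‖⟨U 0, θ⟩‖ ≤ C ‖θ‖_{L¹}`, and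
`IsDistributionOf.eLpNorm_top_le_of_forall_schwartz` applies. [folklore] -/
theorem eLpNorm_top_zero_le_of_continuousInHomBesovOn {s T T₁ : ℝ} {p q : ℝ≥0∞} [Fact (1 ≤ p)]
    (hs0 : s < 0) (hs2 : -2 < s) (hq : 1 ≤ q) (hT₁ : 0 < T₁) (hT₁T : T₁ ≤ T)
    {u : ℝ → EuclideanSpace ℝ ι → EuclideanSpace ℝ ι}
    {U : ℝ → 𝓢'(EuclideanSpace ℝ ι, EuclideanSpace ℂ ι)}
    (hU : ContinuousInHomBesovOn (Ico 0 T) s p q U)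
    (hdist : ∀ t ∈ Ico 0 T, IsDistributionOf (u t) (U t)) {C : ℝ≥0∞} (hC : C < ∞)
    (hb : ∀ t ∈ Ioo 0 T₁, eLpNorm (u t) ∞ volume ≤ C) :
    eLpNorm (u 0) ∞ volume ≤ C := by
  have h0 : (0 : ℝ) ∈ Ico 0 T := ⟨le_rfl, hT₁.trans_le hT₁T⟩
  have hθ : ∀ θ : 𝓢(EuclideanSpace ℝ ι, ℂ), ‖U 0 θ‖ ≤ C.toReal * ∫ x, ‖θ x‖ := by
    intro θ
    have hlim : Tendsto (fun t => U t θ) (𝓝[Ioo 0 T₁] 0) (𝓝 (U 0 θ)) :=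
      (hU.tendsto_apply hs0 hs2 hq θ h0).mono_left
        (nhdsWithin_mono _ fun t ht => ⟨ht.1.le, ht.2.trans_le hT₁T⟩)
    haveI : (𝓝[Ioo (0 : ℝ) T₁] 0).NeBot := by
      rw [← mem_closure_iff_nhdsWithin_neBot, closure_Ioo hT₁.ne]
      exact ⟨le_rfl, hT₁.le⟩
    refine le_of_tendsto ((continuous_norm.tendsto _).comp hlim) ?_
    filter_upwards [self_mem_nhdsWithin] with t ht
    exact (hdist t ⟨ht.1.le, ht.2.trans_le hT₁T⟩).norm_apply_le_of_eLpNorm_top_le hC (hb t ht) θ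
  calc eLpNorm (u 0) ∞ volume ≤ ENNReal.ofReal C.toReal :=
        (hdist 0 h0).eLpNorm_top_le_of_forall_schwartz hθ
    _ = C := ENNReal.ofReal_toReal hC.ne

end InitialSlice

end Literature.Analysis.FluidPDE

end
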